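import Summits.HubbardSuperconductivity.HubbardSuperconductivity.Theorems.WidthHaldaneDefs
import Summits.HubbardSuperconductivity.HubbardSuperconductivity.Theorems.WidthHaldaneDirichletBlockSums
import Summits.HubbardSuperconductivity.HubbardSuperconductivity.Theorems.WidthUniformThermodynamics.Negative.WidthUniformThermodynamicsFreeOpenShell

/-!
# The free two-leg ladder at zero flux: folded momenta, the band in folded form, and the Dirichlet
# bound on cosine sums

First of four files establishing the `U = 0` STIFFNESS twin of
`PerWidthThermodynamics/Negative/ZeroCouplingCompressibility` for crux stmt-HubbardSuperconductivity-18510: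
at zero coupling the free isotropic ladder (`M = 2`) is PARAMAGNETIC at the cruxes' twist `θ₀ = π/3`
(`tubeStiffness L 2 … 0 δ < 0`) on every odd Fermi sea, hence cofinally in `L` at every doping
(`ZeroCouplingStiffness.perWidthThermodynamics_stiffness_false_at_zero_coupling`). This file is the
elementary bookkeeping on `ℤ/L`, sorry-free:

* the FOLDED momentum `|a| = min(a, L - a)` of a residue: `two_mul_fold_le`, `fold_neg`, `cos_fold`
  (`cos(2πa/L) = cos(2π|a|/L)`), `abs_sin_eq_sin_fold`, `fold_natCast`, `fold_eq_zero_iff`,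
  `fold_eq_half_iff`, `fold_eq_fold_iff` (`|a| = |a'| ↔ a' = ±a`), strict monotonicity of the cosine in
  the fold (`cos_fold_lt_cos_fold_iff`), and the identification of the fold-balls with the centred
  blocks of `WidthHaldaneDirichletBlockSums` (`filter_fold_le_eq_block`, `card_filter_fold_le/lt`);
* the untwisted ladder band `ε^0_{L,2}(a,b) = -2cos(2π|a|/L) - (-1)^b` (`ladderBand_zero_eq`): even in
  `a`, strictly increasing in `|a|` within a band, bottoms `ε(0,0) = -3`, `ε(0,1) = -1`;
* **`sum_posPart_cos_le`**, **`sum_cos_le`** — `Σ_{a∈ℤ/L} (cos 2πa/L)₊ ≤ 1/sin(π/L)` (Dirichlet kernel of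
  the block `|a| ≤ ⌊(L-1)/4⌋`), hence `Σ_{k∈F} cos(2πa/L) ≤ 2/sin(π/L)` for EVERY set `F` of ladder
  momenta — the curvature (diamagnetic) cost of a twist is `O(1/L)` uniformly in the filling.

Folklore (tight-binding bands; Dirichlet kernel). No definitions, no named facts. REUSED: `card_block`,
`sum_block_cos_eq`, `sin_pi_div_pos` (DirichletBlockSums), `val_half` (FreeOpenShell),
`ladderTwistedBand` (WidthHaldaneDefs).
-/

noncomputable section

namespace Summit.HubbardSuperconductivity.HubbardSuperconductivity.Theorems.PerWidthThermodynamics.Negative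

set_option linter.dupNamespace false -- summit = problem name (single-conjunct summit), D-0017

open scoped BigOperators Classical
open Finset Summit.HubbardSuperconductivity.HubbardSuperconductivity.Theorems.WidthHaldane
open Summit.HubbardSuperconductivity.HubbardSuperconductivity.Theorems.WidthUniformThermodynamics.Negative

/-! ### The folded momentum `|a| = min(a, L - a)` of a residue `a ∈ ℤ/L` -/

section Fold

variable {L : ℕ} [NeZero L]

/-- `2|a| ≤ L`. [folklore] -/
theorem two_mul_fold_le (a : ZMod L) : 2 * min a.val (L - a.val) ≤ L := by
  have := ZMod.val_lt a
  rcases le_total a.val (L - a.val) with h | h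
  · rw [min_eq_left h]; omega
  · rw [min_eq_right h]; omega

/-- The folded angle `2π|a|/L` lies in `[0, π]`. [folklore] -/
theorem fold_angle_mem (a : ZMod L) :
    0 ≤ 2 * Real.pi * ((min a.val (L - a.val) : ℕ) : ℝ) / L ∧
      2 * Real.pi * ((min a.val (L - a.val) : ℕ) : ℝ) / L ≤ Real.pi := by
  have hL : (0 : ℝ) < L := by exact_mod_cast Nat.pos_of_ne_zero (NeZero.ne L)
  have h2 : 2 * ((min a.val (L - a.val) : ℕ) : ℝ) ≤ L := by exact_mod_cast two_mul_fold_le a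
  refine ⟨by positivity, ?_⟩
  rw [div_le_iff₀ hL]
  nlinarith [Real.pi_pos]

/-- `|-a| = |a|`. [folklore] -/
theorem fold_neg (a : ZMod L) : min (-a).val (L - (-a).val) = min a.val (L - a.val) := by
  rw [ZMod.neg_val]
  split_ifs with h
  · subst h; simp
  · have := ZMod.val_lt a
    have h0 : 0 < a.val := Nat.pos_of_ne_zero ((ZMod.val_ne_zero a).2 h)
    omega

/-- `cos(2π|a|/L) = cos(2πa/L)`. [folklore] -/
theorem cos_fold (a : ZMod L) :
    Real.cos (2 * Real.pi * ((min a.val (L - a.val) : ℕ) : ℝ) / L) = Real.cos (2 * Real.pi * (a.val : ℝ) / L) := by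
  rcases le_total a.val (L - a.val) with h | h
  · rw [min_eq_left h]
  · rw [min_eq_right h]
    have hlt : a.val ≤ L := (ZMod.val_lt a).le
    rw [Nat.cast_sub hlt]
    have hL : (L : ℝ) ≠ 0 := Nat.cast_ne_zero.2 (NeZero.ne L)
    have : 2 * Real.pi * ((L : ℝ) - a.val) / L = 2 * Real.pi - 2 * Real.pi * (a.val : ℝ) / L := by
      field_simp
    rw [this, Real.cos_two_pi_sub]

/-- `|sin(2πa/L)| = sin(2π|a|/L)`. [folklore] -/
theorem abs_sin_eq_sin_fold (a : ZMod L) :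
    |Real.sin (2 * Real.pi * (a.val : ℝ) / L)| = Real.sin (2 * Real.pi * ((min a.val (L - a.val) : ℕ) : ℝ) / L) := by
  obtain ⟨h0, hπ⟩ := fold_angle_mem a
  have hnn := Real.sin_nonneg_of_nonneg_of_le_pi h0 hπ
  rcases le_total a.val (L - a.val) with h | h
  · rw [min_eq_left h] at hnn ⊢
    exact abs_of_nonneg hnn
  · rw [min_eq_right h] at hnn ⊢
    have hlt : a.val ≤ L := (ZMod.val_lt a).le
    rw [Nat.cast_sub hlt] at hnn ⊢
    have hL : (L : ℝ) ≠ 0 := Nat.cast_ne_zero.2 (NeZero.ne L)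
    have e : 2 * Real.pi * ((L : ℝ) - a.val) / L = 2 * Real.pi - 2 * Real.pi * (a.val : ℝ) / L := by
      field_simp
    rw [e, Real.sin_two_pi_sub] at hnn ⊢
    rw [abs_of_nonpos (by linarith)]

/-- `sin(2π(-a)/L) = -sin(2πa/L)`. [folklore] -/
theorem sin_two_pi_mul_val_neg (a : ZMod L) :
    Real.sin (2 * Real.pi * ((-a).val : ℝ) / L) = -Real.sin (2 * Real.pi * (a.val : ℝ) / L) := by
  rw [ZMod.neg_val]
  split_ifs with h
  · subst h; simp
  · have hlt : a.val ≤ L := (ZMod.val_lt a).le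
    rw [Nat.cast_sub hlt]
    have hL : (L : ℝ) ≠ 0 := Nat.cast_ne_zero.2 (NeZero.ne L)
    have e : 2 * Real.pi * ((L : ℝ) - a.val) / L = 2 * Real.pi - 2 * Real.pi * (a.val : ℝ) / L := by
      field_simp
    rw [e, Real.sin_two_pi_sub]

/-- A small natural number is its own fold: `|j| = j` for `2j ≤ L`. [folklore] -/
theorem fold_natCast {j : ℕ} (hj : 2 * j ≤ L) : min ((j : ZMod L).val) (L - (j : ZMod L).val) = j := by
  have hL : 0 < L := Nat.pos_of_ne_zero (NeZero.ne L)
  have hjL : j < L := by omega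
  rw [ZMod.val_natCast, Nat.mod_eq_of_lt hjL]
  exact min_eq_left (by omega)

/-- `|a| = 0 ↔ a = 0`. [folklore] -/
theorem fold_eq_zero_iff (a : ZMod L) : min a.val (L - a.val) = 0 ↔ a = 0 := by
  have := ZMod.val_lt a
  constructor
  · intro h
    rcases le_total a.val (L - a.val) with h' | h'
    · rw [min_eq_left h'] at h; exact (ZMod.val_eq_zero a).1 h
    · rw [min_eq_right h'] at h; omega
  · rintro rfl; simp

/-- For even `L`: `|a| = L/2 ↔ a = L/2`. [folklore] -/
theorem fold_eq_half_iff (hL : Even L) (a : ZMod L) :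
    min a.val (L - a.val) = L / 2 ↔ a = ((L / 2 : ℕ) : ZMod L) := by
  have hlt := ZMod.val_lt a
  obtain ⟨l, hl⟩ := hL
  have hL2 : L / 2 = l := by omega
  constructor
  · intro h
    have hv : a.val = L / 2 := by
      rcases le_total a.val (L - a.val) with h' | h'
      · rwa [min_eq_left h'] at h
      · rw [min_eq_right h'] at h; omega
    rw [← ZMod.natCast_zmod_val a, hv]
  · rintro rfl
    rw [val_half]
    omega

/-- `|a| = |a'| ↔ a' = a ∨ a' = -a`. [folklore] -/
theorem fold_eq_fold_iff (a a' : ZMod L) :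
    min a.val (L - a.val) = min a'.val (L - a'.val) ↔ a' = a ∨ a' = -a := by
  constructor
  · intro h
    have ha := ZMod.val_lt a
    have ha' := ZMod.val_lt a'
    have key : a'.val = a.val ∨ a'.val + a.val = L := by
      rcases le_total a.val (L - a.val) with h1 | h1 <;>
        rcases le_total a'.val (L - a'.val) with h2 | h2
      · rw [min_eq_left h1, min_eq_left h2] at h; omega
      · rw [min_eq_left h1, min_eq_right h2] at h; omega
      · rw [min_eq_right h1, min_eq_left h2] at h; omega
      · rw [min_eq_right h1, min_eq_right h2] at h; omega
    rcases key with k | k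
    · left; exact ZMod.val_injective L k
    · right
      rw [eq_neg_iff_add_eq_zero, ← ZMod.natCast_zmod_val a', ← ZMod.natCast_zmod_val a, ← Nat.cast_add, k,
        ZMod.natCast_self]
  · rintro (rfl | rfl)
    · rfl
    · rw [fold_neg]

/-- Strict monotonicity of the band in the fold: `cos(2π|a|/L) < cos(2π|a'|/L) ↔ |a'| < |a|`. [folklore] -/
theorem cos_fold_lt_cos_fold_iff (a a' : ZMod L) :
    Real.cos (2 * Real.pi * ((min a.val (L - a.val) : ℕ) : ℝ) / L) <
        Real.cos (2 * Real.pi * ((min a'.val (L - a'.val) : ℕ) : ℝ) / L) ↔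
      min a'.val (L - a'.val) < min a.val (L - a.val) := by
  obtain ⟨h0, hπ⟩ := fold_angle_mem a
  obtain ⟨h0', hπ'⟩ := fold_angle_mem a'
  have hL : (0 : ℝ) < L := by exact_mod_cast Nat.pos_of_ne_zero (NeZero.ne L)
  rw [Real.strictAntiOn_cos.lt_iff_gt ⟨h0, hπ⟩ ⟨h0', hπ'⟩, div_lt_div_iff_of_pos_right hL,
    mul_lt_mul_iff_right₀ (by positivity), Nat.cast_lt]

/-- `cos(2π|a|/L) ≤ cos(2π|a'|/L) ↔ |a'| ≤ |a|`. [folklore] -/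
theorem cos_fold_le_cos_fold_iff (a a' : ZMod L) :
    Real.cos (2 * Real.pi * ((min a.val (L - a.val) : ℕ) : ℝ) / L) ≤
        Real.cos (2 * Real.pi * ((min a'.val (L - a'.val) : ℕ) : ℝ) / L) ↔
      min a'.val (L - a'.val) ≤ min a.val (L - a.val) := by
  rw [← not_lt, cos_fold_lt_cos_fold_iff, not_lt]

/-- `cos(2π|a|/L) = cos(2π|a'|/L) ↔ |a| = |a'|`. [folklore] -/
theorem cos_fold_eq_cos_fold_iff (a a' : ZMod L) :
    Real.cos (2 * Real.pi * ((min a.val (L - a.val) : ℕ) : ℝ) / L) =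
        Real.cos (2 * Real.pi * ((min a'.val (L - a'.val) : ℕ) : ℝ) / L) ↔
      min a.val (L - a.val) = min a'.val (L - a'.val) := by
  constructor
  · intro h
    exact le_antisymm ((cos_fold_le_cos_fold_iff a' a).1 h.ge) ((cos_fold_le_cos_fold_iff a a').1 h.le)
  · intro h; rw [h]

/-- **The fold-balls are the centred blocks**: `{a : |a| ≤ m} = {j - m : 0 ≤ j ≤ 2m}` (`2m + 1 ≤ L`). [folklore] -/
theorem filter_fold_le_eq_block (m : ℕ) (h : 2 * m + 1 ≤ L) :
    (univ.filter fun a : ZMod L => min a.val (L - a.val) ≤ m) =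
      (range (2 * m + 1)).image fun j : ℕ => ((j : ZMod L) - (m : ZMod L)) := by
  ext a
  simp only [mem_filter, mem_univ, true_and, mem_image, mem_range]
  have hval : a.val < L := ZMod.val_lt a
  constructor
  · intro ha
    rcases le_total a.val (L - a.val) with h1 | h1
    · rw [min_eq_left h1] at ha
      refine ⟨a.val + m, by omega, ?_⟩
      push_cast
      rw [ZMod.natCast_zmod_val]; ring
    · rw [min_eq_right h1] at ha
      refine ⟨m - (L - a.val), by omega, ?_⟩
      rw [Nat.cast_sub (by omega), Nat.cast_sub hval.le, ZMod.natCast_self, ZMod.natCast_zmod_val]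
      ring
  · rintro ⟨j, hj, rfl⟩
    rcases le_or_gt m j with hmj | hmj
    · have e : ((j : ZMod L) - (m : ZMod L)) = ((j - m : ℕ) : ZMod L) := by rw [Nat.cast_sub hmj]
      rw [e, ZMod.val_natCast, Nat.mod_eq_of_lt (by omega)]
      exact (min_le_left _ _).trans (by omega)
    · have e : ((j : ZMod L) - (m : ZMod L)) = -((m - j : ℕ) : ZMod L) := by
        rw [Nat.cast_sub hmj.le]; ring
      have hne : ((m - j : ℕ) : ZMod L) ≠ 0 := by
        intro h0
        rw [ZMod.natCast_eq_zero_iff] at h0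
        exact absurd (Nat.le_of_dvd (by omega) h0) (by omega)
      rw [e, ZMod.neg_val, if_neg hne, ZMod.val_natCast, Nat.mod_eq_of_lt (by omega)]
      exact (min_le_right _ _).trans (by omega)

/-- `#{a ∈ ℤ/L : |a| ≤ m} = 2m + 1` (`2m + 1 ≤ L`). [folklore] -/
theorem card_filter_fold_le (m : ℕ) (h : 2 * m + 1 ≤ L) :
    (univ.filter fun a : ZMod L => min a.val (L - a.val) ≤ m).card = 2 * m + 1 := by
  rw [filter_fold_le_eq_block m h, card_block m h]

/-- `#{a ∈ ℤ/L : |a| < r} = 2r - 1` (`2r ≤ L`; both sides vanish for `r = 0`). [folklore] -/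
theorem card_filter_fold_lt {r : ℕ} (h : 2 * r ≤ L) :
    (univ.filter fun a : ZMod L => min a.val (L - a.val) < r).card = 2 * r - 1 := by
  rcases Nat.eq_zero_or_pos r with hr | hr
  · subst hr
    rw [Finset.card_eq_zero, Finset.filter_eq_empty_iff]
    intro a _; omega
  have e : (univ.filter fun a : ZMod L => min a.val (L - a.val) < r) =
      univ.filter fun a : ZMod L => min a.val (L - a.val) ≤ r - 1 := by
    ext a; simp only [mem_filter, mem_univ, true_and]; omega
  rw [e, card_filter_fold_le (r - 1) (by omega)]
  omega

end Fold

/-! ### The free ladder band at zero flux, in folded form -/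

section Band

variable {L : ℕ} [NeZero L]

/-- `ε^0_{L,2}(a, b) = -2cos(2π|a|/L) - (-1)^b`. [folklore] -/
theorem ladderBand_zero_eq (k : ZMod L × ZMod 2) :
    ladderTwistedBand L 0 k =
      -2 * Real.cos (2 * Real.pi * ((min k.1.val (L - k.1.val) : ℕ) : ℝ) / L) - (-1) ^ k.2.val := by
  rw [ladderTwistedBand, sub_zero, cos_fold]

/-- The band is even in the long momentum: `ε(-a, b) = ε(a, b)`. [folklore] -/
theorem ladderBand_zero_conj (k : ZMod L × ZMod 2) :
    ladderTwistedBand L 0 (-k.1, k.2) = ladderTwistedBand L 0 k := by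
  rw [ladderBand_zero_eq, ladderBand_zero_eq, fold_neg]

/-- Within one band the level is strictly increasing in `|a|`. [folklore] -/
theorem ladderBand_zero_lt_iff {k k' : ZMod L × ZMod 2} (h : k.2 = k'.2) :
    ladderTwistedBand L 0 k < ladderTwistedBand L 0 k' ↔
      min k.1.val (L - k.1.val) < min k'.1.val (L - k'.1.val) := by
  rw [ladderBand_zero_eq, ladderBand_zero_eq, h, ← cos_fold_lt_cos_fold_iff k'.1 k.1]
  constructor <;> intro h' <;> linarith

/-- Within one band the level is monotone in `|a|`. [folklore] -/
theorem ladderBand_zero_le_iff {k k' : ZMod L × ZMod 2} (h : k.2 = k'.2) :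
    ladderTwistedBand L 0 k ≤ ladderTwistedBand L 0 k' ↔
      min k.1.val (L - k.1.val) ≤ min k'.1.val (L - k'.1.val) := by
  rw [← not_lt, ladderBand_zero_lt_iff h.symm, not_lt]

/-- The bottom of the bonding band: `ε(0, 0) = -3`. [folklore] -/
theorem ladderBand_zero_zero_zero : ladderTwistedBand L 0 ((0 : ZMod L), (0 : ZMod 2)) = -3 := by
  rw [ladderBand_zero_eq]
  simp [ZMod.val_zero]
  norm_num

/-- The bottom of the antibonding band: `ε(0, 1) = -1`. [folklore] -/
theorem ladderBand_zero_zero_one : ladderTwistedBand L 0 ((0 : ZMod L), (1 : ZMod 2)) = -1 := by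
  rw [ladderBand_zero_eq]
  simp [ZMod.val_zero, ZMod.val_one]
  norm_num

/-- The antibonding band lies above `-1`. [folklore] -/
theorem neg_one_le_ladderBand_zero_of_snd_eq_one {k : ZMod L × ZMod 2} (h : k.2 = 1) :
    -1 ≤ ladderTwistedBand L 0 k := by
  rw [ladderBand_zero_eq, h, ZMod.val_one, pow_one]
  have := Real.cos_le_one (2 * Real.pi * ((min k.1.val (L - k.1.val) : ℕ) : ℝ) / L)
  linarith

end Band

/-! ### The cosine sum of any momentum set is at most `2/sin(π/L)` (Dirichlet kernel) -/

section CosSum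

variable {L : ℕ} [NeZero L]

/-- **Positive part of the cosine over `ℤ/L`**: `Σ_a (cos(2πa/L))₊ ≤ 1/sin(π/L)` (`L ≥ 3`): only the
centred block `|a| ≤ ⌊(L-1)/4⌋` contributes, and its Dirichlet sum is `sin((2q+1)π/L)/sin(π/L)`.
[folklore] -/
theorem sum_posPart_cos_le (hL : 3 ≤ L) :
    ∑ a : ZMod L, max (Real.cos (2 * Real.pi * (a.val : ℝ) / L)) 0 ≤ 1 / Real.sin (Real.pi / L) := by
  have hL0 : (0 : ℝ) < L := by exact_mod_cast (show 0 < L by omega)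
  set q : ℕ := (L - 1) / 4 with hq
  have h4q : 4 * q + 1 ≤ L := by omega
  have h4q' : L ≤ 4 * q + 4 := by omega
  have hsin := sin_pi_div_pos (N := L) (by omega)
  -- pointwise: the positive part is supported on the block `|a| ≤ q`, where it equals the cosine
  have key : ∀ a : ZMod L, max (Real.cos (2 * Real.pi * (a.val : ℝ) / L)) 0 ≤
      if min a.val (L - a.val) ≤ q then Real.cos (2 * Real.pi * (a.val : ℝ) / L) else 0 := by
    intro a
    rw [← cos_fold a]
    obtain ⟨h0, hπ⟩ := fold_angle_mem a
    split_ifs with h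
    · refine max_le le_rfl (Real.cos_nonneg_of_neg_pi_div_two_le_of_le (by linarith) ?_)
      rw [div_le_iff₀ hL0]
      have : 4 * ((min a.val (L - a.val) : ℕ) : ℝ) ≤ L := by exact_mod_cast (show 4 * min a.val (L - a.val) ≤ L by omega)
      nlinarith [Real.pi_pos]
    · refine max_le (Real.cos_nonpos_of_pi_div_two_le_of_le ?_ (by linarith [Real.pi_pos])) le_rfl
      rw [le_div_iff₀ hL0]
      have : (L : ℝ) ≤ 4 * ((min a.val (L - a.val) : ℕ) : ℝ) := by
        exact_mod_cast (show L ≤ 4 * min a.val (L - a.val) by omega)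
      nlinarith [Real.pi_pos]
  calc ∑ a : ZMod L, max (Real.cos (2 * Real.pi * (a.val : ℝ) / L)) 0
      ≤ ∑ a : ZMod L, (if min a.val (L - a.val) ≤ q then Real.cos (2 * Real.pi * (a.val : ℝ) / L) else 0) :=
        sum_le_sum fun a _ => key a
    _ = ∑ a ∈ univ.filter (fun a : ZMod L => min a.val (L - a.val) ≤ q), Real.cos (2 * Real.pi * (a.val : ℝ) / L) := by
        rw [Finset.sum_filter]
    _ = Real.sin ((2 * (q : ℝ) + 1) * Real.pi / L) / Real.sin (Real.pi / L) := by
        rw [filter_fold_le_eq_block q (by omega), sum_block_cos_eq q (by omega) (by omega)]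
    _ ≤ 1 / Real.sin (Real.pi / L) := div_le_div_of_nonneg_right (Real.sin_le_one _) hsin.le

/-- **The cosine sum of any set of ladder momenta is at most `2/sin(π/L)`** (two bands, positive
parts). [folklore] -/
theorem sum_cos_le (hL : 3 ≤ L) (F : Finset (ZMod L × ZMod 2)) :
    ∑ k ∈ F, Real.cos (2 * Real.pi * (k.1.val : ℝ) / L) ≤ 2 / Real.sin (Real.pi / L) := by
  calc ∑ k ∈ F, Real.cos (2 * Real.pi * (k.1.val : ℝ) / L)
      ≤ ∑ k ∈ F, max (Real.cos (2 * Real.pi * (k.1.val : ℝ) / L)) 0 := sum_le_sum fun k _ => le_max_left _ _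
    _ ≤ ∑ k : ZMod L × ZMod 2, max (Real.cos (2 * Real.pi * (k.1.val : ℝ) / L)) 0 :=
        sum_le_sum_of_subset_of_nonneg (subset_univ F) fun k _ _ => le_max_right _ _
    _ = 2 * ∑ a : ZMod L, max (Real.cos (2 * Real.pi * (a.val : ℝ) / L)) 0 := by
        rw [Fintype.sum_prod_type, Finset.mul_sum]
        refine sum_congr rfl fun a _ => ?_
        dsimp only
        rw [Finset.sum_const, Finset.card_univ, ZMod.card, nsmul_eq_mul]
        push_cast; ring
    _ ≤ 2 / Real.sin (Real.pi / L) := by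
        rw [div_eq_mul_one_div]
        exact mul_le_mul_of_nonneg_left (sum_posPart_cos_le hL) (by norm_num)

end CosSum

end Summit.HubbardSuperconductivity.HubbardSuperconductivity.Theorems.PerWidthThermodynamics.Negative

end
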